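import Literature.Analysis.FluidPDE.CompressibleEulerImplosionGermUniform
import HarnessLib

/-!
# Buckmaster–Cao-Labora–Gómez-Serrano at γ = 5/3: the `P₀` trajectory with a uniform anchor

The solution issued from `P₀` (Prop. 2.5) in the form needed by the shooting argument of §6:
for every `r ∈ [11/10, 28/25]` it coincides with the explicit germ of
`CompressibleEulerImplosionGermUniform` for ALL `ξ ≤ ξ_A − 1` (a time independent of `r`),
solves (1.8) off the sonic lines with `Z < W` up to its arrival at `P_s`, and has `N_W < 0`
(hence `W` strictly decreasing) along the whole trajectory. The proof is that of
`Monatomic.exists_trajectory_of_profile` with the entry time supplied by `Germ.germ_entry`.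

[cite: BuckmasterCaolaboraGomezserrano2025, Prop. 2.5, Remark 2.6, §6]
-/

noncomputable section

open Set Filter Topology

namespace Literature.Analysis.FluidPDE

namespace BuckmasterCaolaboraGomezserrano2025

namespace Monatomic

namespace Germ

variable {r : ℝ}

/-- [folklore] -/
theorem r_mem (h1 : 11 / 10 ≤ r) (h2 : r ≤ 28 / 25) : 1 < r ∧ r < rstar ∧ r < 2 := by
  have h4 := r4_bounds.1
  have hm := r3_r4_mem
  refine ⟨by linarith, by linarith, by linarith [rstar_lt]⟩

/-- **The `P₀` trajectory with the uniform anchor** (Prop. 2.5 at `γ = 5/3`, for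
`r ∈ [11/10, 28/25]`). [cite: BuckmasterCaolaboraGomezserrano2025, Prop. 2.5, Remark 2.6] -/
theorem exists_P0_trajectory_unif (h1 : 11 / 10 ≤ r) (h2 : r ≤ 28 / 25) :
    ∃ b : ℝ, ξA - 1 < b ∧ ∃ c : ℝ → ℝ × ℝ,
      (∀ ξ : ℝ, ξ ≤ ξA - 1 → c ξ = germ r ξ) ∧
      (∀ ξ ∈ Iio b, HasDerivAt c (field r (c ξ)) ξ) ∧
      (∀ ξ ∈ Iio b, 0 < DW (c ξ).1 (c ξ).2 ∧ DZ (c ξ).1 (c ξ).2 < 0 ∧ (c ξ).2 < (c ξ).1) ∧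
      (∀ ξ ∈ Iio b, NW r (c ξ).1 (c ξ).2 < 0) ∧
      StrictAntiOn (fun ξ => (c ξ).1) (Iio b) ∧
      Tendsto c (𝓝[<] b) (𝓝 (W0 r, Z0 r)) := by
  obtain ⟨hr1, hr, hr2⟩ := r_mem h1 h2
  set ξ₂ : ℝ := ξA with hξ₂def
  have hξ₂ : ∀ ξ, ξ ≤ ξ₂ → 0 < DW (germ r ξ).1 (germ r ξ).2 ∧ DZ (germ r ξ).1 (germ r ξ).2 ≤ -1 ∧
      20 ≤ (germ r ξ).1 ∧ W0 r ≤ (germ r ξ).1 ∧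
      0 ≤ ((germ r ξ).1 - W0 r) + ((germ r ξ).2 - Z0 r) := fun ξ hξ => germ_entry h1 h2 hξ
  set c₀ : ℝ → ℝ × ℝ := germ r with hc₀
  have hsol₀ : ∀ ξ, ξ ≤ ξ₂ → HasDerivAt c₀ (field r (c₀ ξ)) ξ := fun ξ hξ => germ_hasDerivAt h1 h2 hξ
  have hU₀ : ∀ ξ, ξ ≤ ξ₂ → c₀ ξ ∈ offSonic := fun ξ hξ =>
    ⟨(hξ₂ ξ hξ).1.ne', by have := (hξ₂ ξ hξ).2.1; exact fun h => by rw [h] at this; linarith⟩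
  -- continuation to `P_s` from the entry time `a = ξ₂ - 1`
  set a : ℝ := ξ₂ - 1 with ha
  set H : ℝ := (c₀ a).1 - W0 r with hH
  have hin : c₀ a ∈ tri r H := by
    obtain ⟨_, kDZ, _, _, kuv⟩ := hξ₂ a (by simp only [ha]; linarith)
    exact ⟨by simp only [hH]; linarith, kuv, by linarith⟩
  obtain ⟨b, hξ₂b, c, hce, hcd, hcU, htri, hanti, htend⟩ :=
    exists_continuation_tendsto_Ps hr1 hr (H := H) (c₀ := c₀) (a₀ := ξ₂ - 2) (a := a) (T₀ := ξ₂)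
      (by simp only [ha]; linarith) (by simp only [ha]; linarith)
      (fun ξ hξ => hsol₀ ξ hξ.2.le) (fun ξ hξ => hU₀ ξ hξ.2.le) hin
  have hab : a < b := by simp only [ha]; linarith
  -- splice `c₀` (before `a`) with `c`
  set g : ℝ → ℝ × ℝ := fun ξ => if ξ < a then c₀ ξ else c ξ with hg
  have hgc : EqOn g c (Ioo (ξ₂ - 2) b) := fun ξ hξ => by
    by_cases h : ξ < a
    · simp only [hg, if_pos h]; exact (hce ⟨hξ.1, by simp only [ha] at h; linarith⟩).symm
    · simp only [hg, if_neg h]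
  have hgc₀ : ∀ ξ, ξ < ξ₂ → g ξ = c₀ ξ := fun ξ hξ => by
    by_cases h : ξ < a
    · simp only [hg, if_pos h]
    · simp only [hg, if_neg h]
      exact hce ⟨by simp only [ha] at h; linarith, hξ⟩
  have hsol : ∀ ξ ∈ Iio b, HasDerivAt g (field r (g ξ)) ξ := by
    intro ξ hξ
    rcases lt_or_ge ξ ξ₂ with h | h
    · have hev : g =ᶠ[𝓝 ξ] c₀ := Filter.eventually_of_mem (Iio_mem_nhds h) fun s hs => hgc₀ s hs
      rw [hgc₀ ξ h]
      exact (hsol₀ ξ h.le).congr_of_eventuallyEq hev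
    · have hmem : ξ ∈ Ioo (ξ₂ - 2) b := ⟨by linarith, hξ⟩
      have hev : g =ᶠ[𝓝 ξ] c := Filter.eventually_of_mem (isOpen_Ioo.mem_nhds hmem) hgc
      rw [hgc hmem]
      exact (hcd ξ hmem).congr_of_eventuallyEq hev
  have hNW : ∀ ξ ∈ Iio b, NW r (g ξ).1 (g ξ).2 < 0 := by
    intro ξ hξ
    rcases lt_or_ge ξ ξ₂ with h | h
    · rw [hgc₀ ξ h]
      obtain ⟨_, kDZ, _, _, kuv⟩ := hξ₂ ξ h.le
      exact NW_neg_of_triangle hr kuv (by linarith)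
    · have hmem : ξ ∈ Ioo (ξ₂ - 2) b := ⟨by linarith, hξ⟩
      have hIco : ξ ∈ Ico a b := ⟨by simp only [ha]; linarith, hξ⟩
      rw [hgc hmem]
      obtain ⟨ht, _⟩ := htri ξ hIco
      exact NW_neg_of_triangle hr ht.2.1 ht.2.2
  have hΩ : ∀ ξ ∈ Iio b, 0 < DW (g ξ).1 (g ξ).2 ∧ DZ (g ξ).1 (g ξ).2 < 0 ∧ (g ξ).2 < (g ξ).1 := by
    intro ξ hξ
    rcases lt_or_ge ξ ξ₂ with h | h
    · rw [hgc₀ ξ h]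
      obtain ⟨kDW, kDZ, _, _, _⟩ := hξ₂ ξ h.le
      refine ⟨kDW, by linarith, ?_⟩
      have e : DW (c₀ ξ).1 (c₀ ξ).2 - DZ (c₀ ξ).1 (c₀ ξ).2 = ((c₀ ξ).1 - (c₀ ξ).2) / 3 := by
        unfold DW DZ; ring
      nlinarith
    · have hmem : ξ ∈ Ioo (ξ₂ - 2) b := ⟨by linarith, hξ⟩
      have hIco : ξ ∈ Ico a b := ⟨by simp only [ha]; linarith, hξ⟩
      rw [hgc hmem]
      obtain ⟨ht, hDZ⟩ := htri ξ hIco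
      exact ⟨DW_pos_of_triangle hr2 ht.2.1 ht.2.2, hDZ, W_gt_Z_of_triangle hr2 ht.2.1 ht.2.2⟩
  refine ⟨b, by simp only [ha, hξ₂def] at hab; linarith, g,
    fun ξ hξ => hgc₀ ξ (by simp only [hξ₂def] at hξ ⊢; linarith), hsol, hΩ, hNW, ?_, ?_⟩
  · -- `W` strictly decreasing on `(-∞, b)` from `W' = N_W/D_W < 0`
    have hderiv : ∀ ξ ∈ Iio b, HasDerivAt (fun s => (g s).1) ((field r (g ξ)).1) ξ :=
      fun ξ hξ => (hsol ξ hξ).fst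
    refine strictAntiOn_of_deriv_neg (convex_Iio b)
      (fun ξ hξ => (hderiv ξ hξ).continuousAt.continuousWithinAt) ?_
    intro ξ hξ
    rw [interior_Iio] at hξ
    rw [(hderiv ξ hξ).deriv]
    show NW r (g ξ).1 (g ξ).2 / DW (g ξ).1 (g ξ).2 < 0
    exact div_neg_of_neg_of_pos (hNW ξ hξ) (hΩ ξ hξ).1
  · -- the limit
    have hev : g =ᶠ[𝓝[<] b] c :=
      Filter.eventually_of_mem (Ioo_mem_nhdsLT hab) fun ξ hξ =>
        hgc ⟨by simp only [ha] at hξ; linarith [hξ.1], hξ.2⟩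
    exact htend.congr' (hev.mono fun ξ hξ => hξ.symm)

/-- At the anchor time `ξ_A − 1` the trajectory is far out: `W ≥ 20`, `D_Z ≤ −1`, `D_W > 0`.
[cite: BuckmasterCaolaboraGomezserrano2025, Prop. 2.5 (proof)] -/
theorem germ_anchor (h1 : 11 / 10 ≤ r) (h2 : r ≤ 28 / 25) :
    20 ≤ (germ r (ξA - 1)).1 ∧ DZ (germ r (ξA - 1)).1 (germ r (ξA - 1)).2 ≤ -1 ∧
      0 < DW (germ r (ξA - 1)).1 (germ r (ξA - 1)).2 := by
  obtain ⟨hDW, hDZ, hW, _, _⟩ := germ_entry h1 h2 (by unfold ξA; norm_num : ξA - 1 ≤ ξA)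
  exact ⟨hW, hDZ, hDW⟩

end Germ

end Monatomic

end BuckmasterCaolaboraGomezserrano2025

end Literature.Analysis.FluidPDE
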